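import Summits.AnomalousDissipation.AnomalousDissipation.Theorems.BaireTransferDenseLoudDesignerForcesErgodicTubeOrbitClassical
import Literature.Analysis.FunctionSpaces.TorusClassicalNSExhaustion

/-!
# Closed orbits of the model map are classical time-periodic Navier–Stokes solutions (registered tools stub S6g
# `stub_closedOrbitClassicalTools` of block N, line `ergodic-budget-selection-closing`, crux `BaireTransfer.DenseLoudDesignerForces`,
# stmt-AnomalousDissipation-1143)

Summit-side assembly over the ACCEPTED definitions `ModelFrame`, `ModelFrame.IsMild`, `ModelFrame.modelMap`
(`…ErgodicModelDefs.lean`), the exact semigroup law of the model map (S6b `stub_modelSemigroupTools`), the identification of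
orbit segments with classical trajectories (S6h `ModelFrame.exists_classical_of_orbit`, `…ErgodicTubeOrbitClassical.lean`) and
the classical-solution bookkeeping of the tree (`exists_of_forall_nat`, `sub_pressure_apply`, `pressure_sub_eq_of_eventuallyEq`,
`comp_add_const`, `periodic_extension`):

* `stub_closedOrbitClassicalTools` — the REGISTERED tools stub S6g.  With the tube property of S6a there is a UNIFORM level
  `R` such that for every `z ∈ U` whose model orbit stays in `U` on `[0, T]`, `T > 0`, with `g T z = z`, there is a global
  classical mean-zero `T`-periodic solution `(u, p)` of NS_ν(f_c) with `‖∇u(t)‖₂² ≤ R` whose states on `[0, T]` are the frame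
  images of the orbit, `F.S (g t z) = [u t]`.  Proof: the semigroup law and `g T z = z` make the orbit `T`-periodic and keep it
  in `U` for all times; S6h identifies it on every `(0, (n+1)T]` with a classical trajectory (level `R = E₂`); these agree on
  overlaps (same states, smooth slices) and exhaust `[T/2, ∞)`; the velocity is `T`-periodic (same states), so is the pressure
  normalised at the base point (the velocity determines the pressure up to a function of time), and the periodic extension to
  all of `ℝ` is classical by locality in time.

References: J. C. Robinson, J. L. Rodrigo, W. Sadowski, *The Three-Dimensional Navier–Stokes Equations* (CUP 2016), §8.1;
C. Foias, O. Manley, R. Rosa, R. Temam, *Navier–Stokes Equations and Turbulence* (CUP 2001), Ch. IV §2.  Nothing is asserted;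
no definition is added.
-/

set_option linter.dupNamespace false

noncomputable section

open Set Function MeasureTheory Filter
open scoped InnerProductSpace Topology

namespace Summit.AnomalousDissipation.AnomalousDissipation.Theorems.DenseLoudDesignerForces.Ergodic

open Literature.Analysis.FunctionSpaces Literature.Analysis.FunctionSpaces.Torus
open Literature.Analysis.FluidPDE Literature.Analysis.FluidPDE.Torus
open Summit.AnomalousDissipation.AnomalousDissipation.Theses.BaireTransfer
open Summit.AnomalousDissipation.AnomalousDissipation.Theorems.DenseLoudDesignerForces.Negative

/-- **Tools stub S6g — CLOSED MODEL ORBITS ARE CLASSICAL PERIODIC SOLUTIONS** (block N; field `closedOrbit` of `IsSmoothModelOf`).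
With the tube property of S6a (`U ⊆ U'`, `U'` open and bounded, admissible mild solutions from `U` computing the model map `g`
on `[0, 3]`) there is a uniform `R` such that: if `z ∈ U` has a `g`-orbit staying in `U` up to time `T > 0` with `g T z = z`,
then there is a GLOBAL classical mean-zero solution `(u, p)` of NS_ν(f_c), `T`-periodic in time, with `‖∇u(t)‖₂² ≤ R` for all
`t`, whose states on `[0, T]` are the frame images of the orbit: `F.S (g t z) = [u t]`.  Proof: the exact semigroup law (S6b)
and `g T z = z` give `g (s + T) z = g s z` for `s ≥ 0`, so the orbit stays in `U` for all times; S6h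
(`ModelFrame.exists_classical_of_orbit`, uniform level `E₂ =: R`) identifies it on every `(0, (n+1)T]` with a classical
mean-zero trajectory; these agree on overlaps (equal states of smooth slices), exhaust `[T/2, ∞)` (`exists_of_forall_nat`),
the velocity is `T`-periodic (equal states) and so is the pressure normalised at the base point
(`pressure_sub_eq_of_eventuallyEq` against the time translate `comp_add_const`); the `T`-periodic extension is a classical
solution on all of `ℝ` (`periodic_extension`). [folklore] -/
theorem stub_closedOrbitClassicalTools {S : Finset (Fin 3 → ℤ)} {c : ↥S → (EuclideanSpace ℂ (Fin 3))} {ν : ℝ} (hν : 0 < ν)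
    (F : ModelFrame) (xF : Hsp) (hxF : F.S xF = stateOf (force S c)) {U U' : Set Hsp} (hU' : IsOpen U')
    (hbdd : Bornology.IsBounded U') (hUU' : U ⊆ U')
    (htube : ∀ y ∈ U, ∀ t ∈ Icc (0 : ℝ) 3, ∃ (ht : 0 ≤ t) (z : C(Icc (0 : ℝ) t, Hsp)),
      F.IsMild ν xF ht y z ∧ (∀ r, z r ∈ U') ∧ F.modelMap ν xF U' t y = z ⟨t, ht, le_rfl⟩) :
    ∃ R : ℝ, ∀ z ∈ U, ∀ T : ℝ, 0 < T → (∀ t ∈ Icc 0 T, F.modelMap ν xF U' t z ∈ U) → F.modelMap ν xF U' T z = z →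
      ∃ (u : ℝ → (UnitAddTorus (Fin 3)) → (EuclideanSpace ℝ (Fin 3))) (p : ℝ → (UnitAddTorus (Fin 3)) → ℝ),
        IsClassicalNSSolutionOn univ ν (fun _ => force S c) u p ∧ (∀ t, HasZeroMean (u t)) ∧ Function.Periodic u T ∧
        (∀ t, gradNormSq (u t) ≤ R) ∧ ∀ t ∈ Icc 0 T, F.S (F.modelMap ν xF U' t z) = stateOf (u t) := by
  have _ := hU'
  have htube' : ∀ y ∈ U, ∀ t ∈ Icc (0 : ℝ) 3, ∃ (ht : 0 ≤ t) (z : C(Icc (0 : ℝ) t, Hsp)),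
      F.IsMild ν xF ht y z ∧ ∀ r, z r ∈ U' := fun y hy t ht => by
    obtain ⟨ht0, z, hz, hzU, -⟩ := htube y hy t ht
    exact ⟨ht0, z, hz, hzU⟩
  obtain ⟨E₂, hE₂⟩ := ModelFrame.exists_classical_of_orbit hν F xF hxF hbdd hUU' htube
  obtain ⟨hg0, hsg⟩ := stub_modelSemigroupTools F hν xF hUU' htube'
  refine ⟨E₂, fun z hz T hT horb hfix => ?_⟩
  -- notation for the model map
  set g : ℝ → Hsp → Hsp := F.modelMap ν xF U' with hgdef
  -- the orbit is `T`-periodic and stays in `U` for all times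
  have hper : ∀ s : ℝ, 0 ≤ s → g (s + T) z = g s z := fun s hs => by
    rw [hsg s T hs hT.le z hz horb, hfix]
  have horb' : ∀ n : ℕ, ∀ t ∈ Icc 0 (((n : ℝ) + 1) * T), g t z ∈ U := by
    intro n
    induction n with
    | zero =>
      intro t ht
      simp only [Nat.cast_zero, zero_add, one_mul] at ht
      exact horb t ht
    | succ n ih =>
      intro t ht
      push_cast at ht
      by_cases htn : t ≤ ((n : ℝ) + 1) * T
      · exact ih t ⟨ht.1, htn⟩
      · have h1 : 0 ≤ t - T := by nlinarith [not_le.1 htn, hT]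
        have h2 := hper (t - T) h1
        rw [sub_add_cancel] at h2
        rw [h2]
        exact ih (t - T) ⟨h1, by linarith [ht.2]⟩
  -- classical pieces on `(0, (n+1)T]`
  have hpiece : ∀ n : ℕ, ∃ (u : ℝ → (UnitAddTorus (Fin 3)) → (EuclideanSpace ℝ (Fin 3)))
      (p : ℝ → (UnitAddTorus (Fin 3)) → ℝ),
      IsClassicalNSSolutionOn (Ioc 0 (((n : ℝ) + 1) * T)) ν (fun _ => force S c) u p ∧
      (∀ t ∈ Ioc 0 (((n : ℝ) + 1) * T), HasZeroMean (u t)) ∧ (∀ t ∈ Ioc 0 (((n : ℝ) + 1) * T), gradNormSq (u t) ≤ E₂) ∧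
      ∀ t ∈ Ioc 0 (((n : ℝ) + 1) * T), F.S (g t z) = stateOf (u t) := fun n => by
    obtain ⟨u, p, hu, hum, huM, huid, -, -⟩ := hE₂ z hz (((n : ℝ) + 1) * T) (by positivity) (horb' n)
    exact ⟨u, p, hu, hum, huM, huid⟩
  choose u p hu hum huM huid using hpiece
  have hus : ∀ n : ℕ, ∀ t ∈ Ioc 0 (((n : ℝ) + 1) * T), IsSmooth (u n t) := fun n t ht =>
    (hu n).smooth_velocity.isSmooth_slice ht
  -- consistency on overlaps: equal states of smooth slices
  have hcons : ∀ (n m : ℕ) (t : ℝ), t ∈ Ioc 0 (((n : ℝ) + 1) * T) → t ∈ Ioc 0 (((m : ℝ) + 1) * T) → u n t = u m t :=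
    fun n m t htn htm => eq_of_stateOf_eq (hus n t htn) ((hu n).divFree t htn) (hum n t htn) (hus m t htm)
      ((hu m).divFree t htm) (hum m t htm) ((huid n t htn).symm.trans (huid m t htm))
  -- exhaustion of `[T/2, ∞)`
  have hδ : 0 < T / 2 := half_pos hT
  have hlt : ∀ n : ℕ, T / 2 < ((n : ℝ) + 1) * T := fun n => by nlinarith [hT, (Nat.cast_nonneg n : (0 : ℝ) ≤ n)]
  have hmem : ∀ n : ℕ, T / 2 ∈ Ioc 0 (((n : ℝ) + 1) * T) := fun n => ⟨hδ, (hlt n).le⟩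
  have htop : Tendsto (fun m : ℕ => ((m : ℝ) + 1) * T) atTop atTop :=
    (tendsto_atTop_add_const_right _ 1 tendsto_natCast_atTop_atTop).atTop_mul_const hT
  obtain ⟨W, P, hW, hWeq⟩ := IsClassicalNSSolutionOn.exists_of_forall_nat hν.le (a := T / 2) htop
    (fun m => (hu m).mono (fun t ht => ⟨hδ.trans_le ht.1, ht.2⟩) (uniqueDiffOn_Icc (hlt m))) fun m =>
    hcons m 0 _ (hmem m) (hmem 0)
  -- values of the glued velocity
  have hWval : ∀ t : ℝ, T / 2 ≤ t → ∃ m : ℕ, t ∈ Ioc 0 (((m : ℝ) + 1) * T) ∧ W t = u m t := by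
    intro t ht
    obtain ⟨m, hm⟩ := (htop.eventually (eventually_ge_atTop t)).exists
    exact ⟨m, ⟨hδ.trans_le ht, hm⟩, hWeq m t ⟨ht, hm⟩⟩
  have hWst : ∀ t : ℝ, T / 2 ≤ t → IsSmooth (W t) ∧ IsDivFree (W t) ∧ HasZeroMean (W t) ∧ gradNormSq (W t) ≤ E₂ ∧
      F.S (g t z) = stateOf (W t) := by
    intro t ht
    obtain ⟨m, htm, hWm⟩ := hWval t ht
    rw [hWm]
    exact ⟨hus m t htm, (hu m).divFree t htm, hum m t htm, huM m t htm, huid m t htm⟩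
  -- the normalised pressure; periodicity on `(T/2, ∞)`
  set Pn : ℝ → (UnitAddTorus (Fin 3)) → ℝ := fun t x => P t x - P t 0 with hPn
  have hWI : IsClassicalNSSolutionOn (Ioi (T / 2)) ν (fun _ => force S c) W Pn :=
    (hW.sub_pressure_apply 0).mono Ioi_subset_Ici_self (uniqueDiffOn_Ioi _)
  have hperW : ∀ t ∈ Ioi (T / 2), W (t + T) = W t := by
    intro t ht
    have ht' : T / 2 ≤ t := le_of_lt ht
    have htT : T / 2 ≤ t + T := by linarith
    obtain ⟨hs1, hd1, hm1, -, hst1⟩ := hWst (t + T) htT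
    obtain ⟨hs2, hd2, hm2, -, hst2⟩ := hWst t ht'
    refine eq_of_stateOf_eq hs1 hd1 hm1 hs2 hd2 hm2 ?_
    rw [← hst1, ← hst2, hper t (hδ.le.trans ht')]
  have hperP : ∀ t ∈ Ioi (T / 2), Pn (t + T) = Pn t := by
    intro t ht
    have h₁ := hWI.comp_add_const T
    have hS₁ : (fun s => s + T) ⁻¹' Ioi (T / 2) ∈ 𝓝 t := by
      refine (isOpen_Ioi.preimage (continuous_id.add continuous_const : Continuous fun s : ℝ => s + T)).mem_nhds ?_
      show T / 2 < t + T
      linarith [mem_Ioi.1 ht]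
    have heq : ∀ᶠ τ in 𝓝 t, W (τ + T) = W τ := by
      filter_upwards [Ioi_mem_nhds ht] with τ hτ using hperW τ hτ
    funext x
    have key := h₁.pressure_sub_eq_of_eventuallyEq hWI hS₁ (Ioi_mem_nhds ht) heq x 0
    simp only [hPn, sub_self, sub_zero] at key
    simpa only [hPn] using key
  -- the periodic extension to all of `ℝ`
  obtain ⟨V, Q, hV, hVper, -, hVW, -⟩ := hWI.periodic_extension hT (fun _ => rfl) hperW hperP
  -- every time is a translate of a time in `(T/2, ∞)`
  have hshift : ∀ t : ℝ, ∃ n : ℕ, T / 2 < t + n * T ∧ V t = W (t + n * T) := by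
    intro t
    obtain ⟨n, hn⟩ := exists_nat_gt ((T / 2 - t) / T)
    have h1 : T / 2 < t + n * T := by
      rw [div_lt_iff₀ hT] at hn
      linarith
    refine ⟨n, h1, ?_⟩
    rw [← hVW _ h1, (hVper.nat_mul n) t]
  refine ⟨V, Q, hV, fun t => ?_, hVper, fun t => ?_, fun t ht => ?_⟩
  · obtain ⟨n, hn, hVt⟩ := hshift t
    rw [hVt]
    exact (hWst _ hn.le).2.2.1
  · obtain ⟨n, hn, hVt⟩ := hshift t
    rw [hVt]
    exact (hWst _ hn.le).2.2.2.1
  · have htT : T / 2 < t + T := by linarith [ht.1]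
    rw [← hVper t, hVW _ htT, ← (hWst _ htT.le).2.2.2.2, hper t ht.1]

end Summit.AnomalousDissipation.AnomalousDissipation.Theorems.DenseLoudDesignerForces.Ergodic

end
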